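import Summits.Ventures.HodgeRepro.Night3Poincare
import Summits.Ventures.HodgeRepro.Night3GSetFormSymm

/-!
# The radical of the concrete form is the kernel of `y ↦ y ∧ Λ`

Blind re-derivation cell `pub-hodge-repro`, seat `night-3` (gen 6, row D on the model; NIGHT3.md §13.8).  Imports
gen 6's `Night3Poincare` (Poincaré duality on the wedge model: the top-degree pairing `topPair` is perfect) and
`Night3GSetFormSymm` (`Qc_eq_zero_of_mul_Λc_eq_zero`).  Namespace `HodgeRepro.Night3.GSetModel`.

* `Qc_eq_topPair`: the Poincaré-pairing reading `Q′(x, y) = ∫ x ∧ (y ∧ Λ) = topPair x (y ∧ Λ)`;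
* **`forall_Qc_eq_zero_iff_mul_Λc_eq_zero`**: `Q′(·, y) = 0 ⟺ y ∧ Λ = 0` — THE RADICAL OF `Q′` IS THE KERNEL OF THE
  LEFSCHETZ-TYPE MAP `y ↦ y ∧ Λ : H^n → H^{n + 2(m−1)n}`; hence (`Qc_separatingRight_iff`) `Q′` is right-separating
  on `H^n(B)` exactly when `∧Λ` is injective on `H^n(B)` (the hard-Lefschetz shape — NOT claimed; the route uses
  only the Weil space, where injectivity is gen 6's `eq_zero_of_mem_weilSpace_of_mul_Λc_eq_zero`).

READING: Lemma P step (2)'s «every line pairs non-trivially with some line» is the statement that `∧Λ` is injective on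
the Weil space; Poincaré duality turns the form-language of the route into the cup-product language (multiplication
by `Λ^{m−1}` on the Weil classes), on the kernel.  `Alg` is not mentioned; nothing here closes S4; nothing here says
anything about the status of the Hodge conjecture for CM abelian varieties, which is NOT proved.
-/

set_option autoImplicit false
open Finset Module
open scoped Pointwise
namespace HodgeRepro.Night3.GSetModel

open HodgeRepro.CMHodgeOn ExteriorAlgebra

variable {G : Type*} [Group G] [Fintype G] [DecidableEq G] [LinearOrder G]

/-- `y ∧ Λ` as an element of `⋀^{n + 2(m−1)n}`. -/
noncomputable def mulΛ (c : G) (Φ₀ : Finset G) {n : ℕ} (a : Fin n → G → ℂ) (y : Hn G n) :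
    ⋀[ℂ]^(n + 2 * (Φ₀.card - 1) * n) (V G n) :=
  ⟨(y : ExteriorAlgebra ℂ (V G n)) * Λc c Φ₀ a, ExtTop.mul_mem_add y.2 (coe_Λc_mem c Φ₀ a)⟩

omit [DecidableEq G] [LinearOrder G] in
/-- The underlying element of `mulΛ c Φ₀ a y` is `y * Λ`. -/
@[simp] theorem coe_mulΛ (c : G) (Φ₀ : Finset G) {n : ℕ} (a : Fin n → G → ℂ) (y : Hn G n) :
    (mulΛ c Φ₀ a y : ExteriorAlgebra ℂ (V G n)) = y * Λc c Φ₀ a := rfl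

variable {c : G} (hc : IsComplexConj c) {Φ₀ : Finset G} (hΦ : IsCMType c Φ₀) {n : ℕ} (a : Fin n → G → ℂ)

omit [LinearOrder G] in
include hc hΦ in
/-- The degree count of the Poincaré pairing of `Q′`: `|Fin n × G| = n + (n + 2(m−1)n)`. -/
theorem card_lex_eq' : Fintype.card (Lex (Fin n × G)) = n + (n + 2 * (Φ₀.card - 1) * n) := by
  rw [card_lex_eq hc hΦ n, Nat.add_assoc]

/-- **The Poincaré-pairing reading of `Q′`**: `Q′(x, y) = topPair x (y ∧ Λ)`. -/
theorem Qc_eq_topPair (x y : Hn G n) :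
    Qc hc hΦ a x y = ExtTop.topPair (lexBasis n) n (n + 2 * (Φ₀.card - 1) * n) (card_lex_eq' hc hΦ) x
      (mulΛ c Φ₀ a y) := by
  rw [Qc_apply, ExtTop.topPair_apply]
  have h : (⟨(x : ExteriorAlgebra ℂ (V G n)) * y * Λc c Φ₀ a, ExtTop.mul_mul_mem x y (coe_Λc_mem c Φ₀ a)⟩ :
      ⋀[ℂ]^(n + n + 2 * (Φ₀.card - 1) * n) (V G n)) =
      ⟨(x : ExteriorAlgebra ℂ (V G n)) * (y * Λc c Φ₀ a), by
        rw [← mul_assoc]; exact ExtTop.mul_mul_mem x y (coe_Λc_mem c Φ₀ a)⟩ := by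
    ext
    exact mul_assoc _ _ _
  rw [h]
  exact ExtTop.ιMultiDual_univPC_congr (lexBasis n) (Nat.add_assoc n n _) _ _ _ _

/-- **The radical of `Q′` is the kernel of `y ↦ y ∧ Λ`**: `Q′(x, y) = 0` for every `x` iff `y ∧ Λ = 0`. -/
theorem forall_Qc_eq_zero_iff_mul_Λc_eq_zero (y : Hn G n) :
    (∀ x : Hn G n, Qc hc hΦ a x y = 0) ↔ (y : ExteriorAlgebra ℂ (V G n)) * Λc c Φ₀ a = 0 := by
  constructor
  · intro h
    have hz : mulΛ c Φ₀ a y = 0 :=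
      ExtTop.eq_zero_of_forall_topPair_eq_zero_right (lexBasis n) (card_lex_eq' hc hΦ) (mulΛ c Φ₀ a y) fun x => by
        rw [← Qc_eq_topPair hc hΦ a x y]; exact h x
    exact congrArg Subtype.val hz
  · intro h x
    exact Qc_eq_zero_of_mul_Λc_eq_zero hc hΦ a h x

/-- **`Q′` is right-separating on `H^n(B)` iff `∧Λ` is injective on `H^n(B)`** (the hard-Lefschetz shape; not claimed
for the wedge model in general). -/
theorem Qc_separatingRight_iff :
    (Qc hc hΦ a).SeparatingRight ↔
      ∀ y : Hn G n, (y : ExteriorAlgebra ℂ (V G n)) * Λc c Φ₀ a = 0 → y = 0 := by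
  constructor
  · intro h y hy
    exact h y ((forall_Qc_eq_zero_iff_mul_Λc_eq_zero hc hΦ a y).mpr hy)
  · intro h y hy
    exact h y ((forall_Qc_eq_zero_iff_mul_Λc_eq_zero hc hΦ a y).mp hy)

end HodgeRepro.Night3.GSetModel
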